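import Literature.MathematicalPhysics.KineticTheory.VelocityFlipNoise
import Literature.MathematicalPhysics.KineticTheory.LangevinChainHormander
import Literature.Analysis.Hypoelliptic.CoupledSystem
import Summits.AtomisticToContinuum.FouriersLaw.Theorems.VanishingNoiseTransferNoisyFourierFlipSteadyStateHasSmoothDensityAux1
import Summits.AtomisticToContinuum.FouriersLaw.Theorems.OddSectorIrreversibilityOddDensityIsCorrectorRegularity
import HarnessLib

/-!
# Stub `stub_flipSteadyState_hasSmoothDensity` of line `sector-dirichlet-gluing`
(crux `VanishingNoiseTransfer.NoisyFourier`, item stmt-AtomisticToContinuum-11977)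

**Weak flip steady states of the pinned anharmonic chain have smooth densities.** For the chain
`P = pinnedChain ω₂ lam β γ` (`ω₂, lam, β, γ > 0`, `N ≥ 1` sites, baths at `T_L, T_R > 0`) with
Bernardin–Olla velocity flips at rate `ε > 0`, a weak flip steady state `μ`
(`OscillatorChain.IsFlipSteadyState`: probability measure with `∫ (L f + ε S f) dμ = 0` for all
`f ∈ C_c^∞`, `S f = ∑_i (f ∘ Θ_i - f)`, `Θ_i` the flip of the `i`-th momentum) has a `C^∞` density
with respect to Liouville measure (`HasSmoothDensity μ`).

Proof (Hörmander 1967 Thm 1.1 run jointly over the flip group, `isSmoothOn_of_coupledSystem`):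
for `w ⊆ {0, …, N-1}` let `Θ_w` be the multi-site flip (a linear isometric involution of phase
space, `exists_multiFlip_clEquiv`) and `u_w = (Θ_w)_* μ` read as a
distribution. Testing the steady-state equation against `φ ∘ Θ_w` gives
`⟨u_w, ᵗP_w φ⟩ = -ε ∑_i ⟨u_{w ∆ {i}}, φ⟩` with `ᵗP_w φ = ((L - Nε)(φ ∘ Θ_w)) ∘ Θ_w`; and
`L - Nε = ᵗ(X_L² + X_R² + X₀ + (2γ - Nε))` is the formal transpose of a Hörmander operator
(`hormanderTranspose_eq_generator`, `X₀ = -drift`, `X_b = √(γT_b) ∂_{p_b}`), so `ᵗP_w` is the formal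
transpose of the CONJUGATED Hörmander operator with fields `Θ_w X₀ Θ_w`, `Θ_w X_b Θ_w = ±X_b`
(`hormanderTranspose_comp_equiv`), which is again bracket-generating
(`isBracketGenerating_elim_conj` + CEHR Prop. 4.1 `isBracketGenerating_hormanderFamily`, as
`V'' = 1 + 3βr² > 0`, `γ T_L > 0`). Hence `(u_w)_w` solves a square system with diagonal Hörmander
principal parts and the constant coupling `a_{w w'} = -ε [∃ i, w' = w ∆ {i}]`; by
`Literature.Analysis.Hypoelliptic.isSmoothOn_of_coupledSystem` every `u_w`, in particular
`u_∅ = μ`, is a smooth function, and `IsSmoothOn.exists_eq_withDensity` turns this into a smooth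
nonnegative density.
-/

noncomputable section

open MeasureTheory Filter Topology Set Function Finset TopologicalSpace
open scoped ContDiff ENNReal BigOperators Distributions

namespace Summit.AtomisticToContinuum.FouriersLaw.Cruxes.NoisyFourier.SectorDirichletGluing

open Literature.MathematicalPhysics.KineticTheory.HeatConduction
open Literature.Analysis.Distribution Literature.Analysis.Hypoelliptic

variable {N : ℕ}

/-! ### The multi-site momentum flips `Θ_w`, `w ⊆ {0, …, N-1}` -/

/-- **The multi-site momentum flip `ω ↦ ω^w = (q, (if j ∈ w then -p_j else p_j)_j)` is a
continuous linear equivalence of phase space, equal to its own inverse** (the composition of the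
commuting single-site flips `momentumFlip i`, `i ∈ w`; Bernardin–Olla 2011 §2.1). [folklore] -/
theorem exists_multiFlip_clEquiv (w : Finset (Fin N)) :
    ∃ F : PhaseSpace N ≃L[ℝ] PhaseSpace N,
      (∀ x, F x = (x.1, fun j => if j ∈ w then -x.2 j else x.2 j)) ∧
      ∀ x, F.symm x = (x.1, fun j => if j ∈ w then -x.2 j else x.2 j) := by
  -- adapted from `exists_multiFlip_equiv` (Literature/MathematicalPhysics/KineticTheory/VelocityFlipGroup.lean)
  set Φ : PhaseSpace N → PhaseSpace N := fun x => (x.1, fun j => if j ∈ w then -x.2 j else x.2 j)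
    with hΦ
  have hinv : ∀ x, Φ (Φ x) = x := fun x => by
    refine Prod.ext rfl (funext fun j => ?_)
    simp only [hΦ]
    split_ifs <;> ring
  let Lw : PhaseSpace N →ₗ[ℝ] PhaseSpace N :=
    { toFun := Φ
      map_add' := fun x y => by
        refine Prod.ext rfl (funext fun j => ?_)
        simp only [hΦ, Prod.snd_add, Pi.add_apply]
        split_ifs <;> ring
      map_smul' := fun c x => by
        refine Prod.ext rfl (funext fun j => ?_)
        simp only [hΦ, Prod.smul_snd, Pi.smul_apply, smul_eq_mul, RingHom.id_apply]
        split_ifs <;> ring }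
  let Ew : PhaseSpace N ≃ₗ[ℝ] PhaseSpace N :=
    { Lw with
      invFun := Φ
      left_inv := hinv
      right_inv := hinv }
  have hc : Continuous Φ := by
    refine continuous_fst.prodMk (continuous_pi fun j => ?_)
    by_cases hj : j ∈ w
    · simp only [hj, if_true]
      exact ((continuous_apply j).comp continuous_snd).neg
    · simp only [hj, if_false]
      exact (continuous_apply j).comp continuous_snd
  let Fw : PhaseSpace N ≃L[ℝ] PhaseSpace N :=
    { Ew with continuous_toFun := hc, continuous_invFun := hc }
  exact ⟨Fw, fun _ => rfl, fun _ => rfl⟩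

/-- **`(ω^i)^w = ω^{w ∆ {i}}`**: a single-site flip followed by the multi-site flip `w` is the
multi-site flip of the toggled set. [folklore] -/
theorem multiFlip_momentumFlip_eq {A : Finset (Fin N) → PhaseSpace N ≃L[ℝ] PhaseSpace N}
    (hA : ∀ w x, A w x = (x.1, fun j => if j ∈ w then -x.2 j else x.2 j))
    (w : Finset (Fin N)) (i : Fin N) (x : PhaseSpace N) :
    A w (momentumFlip i x) = A (symmDiff w {i}) x := by
  -- adapted from `multiFlip_momentumFlip` (Literature/MathematicalPhysics/KineticTheory/VelocityFlipGroup.lean)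
  rw [hA, hA, momentumFlip_fst]
  refine Prod.ext rfl (funext fun j => ?_)
  simp only [Finset.mem_symmDiff, Finset.mem_singleton]
  by_cases hj : j = i
  · subst hj
    rw [momentumFlip_snd_self]
    by_cases hw : j ∈ w <;> simp [hw]
  · rw [momentumFlip_snd_of_ne hj]
    by_cases hw : j ∈ w <;> simp [hw, hj]

/-- The empty multi-site flip is the identity. [folklore] -/
theorem multiFlip_empty_eq {A : Finset (Fin N) → PhaseSpace N ≃L[ℝ] PhaseSpace N}
    (hA : ∀ w x, A w x = (x.1, fun j => if j ∈ w then -x.2 j else x.2 j)) (x : PhaseSpace N) :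
    A ∅ x = x := by
  rw [hA]
  simp

/-! ### The flip-conjugated Fokker–Planck operators -/

/-- **The flip-noisy generator against a conjugated test function.** For `g` smooth,
`(L - Nε) g (x) = L_ε g (x) - ε ∑_i g (Θ_i x)` where `L_ε = L + ε S` is the flip-noisy generator
(`flipGenerator_apply`: `S g = ∑_i (g ∘ Θ_i - g)` has `N` terms). [folklore] -/
theorem generator_sub_eq_flipGenerator_sub (P : OscillatorChain) (T_L T_R ε : ℝ)
    (g : PhaseSpace N → ℝ) (x : PhaseSpace N) :
    P.generator N T_L T_R g x - (N : ℝ) * ε * g x =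
      P.flipGenerator N T_L T_R ε g x - ε * ∑ i : Fin N, g (momentumFlip i x) := by
  rw [P.flipGenerator_apply, Finset.sum_sub_distrib, Finset.sum_const, Finset.card_univ,
    Fintype.card_fin, nsmul_eq_mul]
  ring

/-- **Stub 1b-α of line `sector-dirichlet-gluing` — weak flip steady states have smooth
densities.** For `ω₂, lam, β, γ > 0`, `ε > 0`, `N ≥ 1`, `T_L, T_R > 0`, every weak flip steady
state `μ` of the pinned anharmonic chain with velocity flips at rate `ε` has a smooth density with
respect to Liouville measure: the pushforwards `(Θ_w)_* μ` under the multi-site flips solve a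
square system of distributional equations with diagonal, bracket-generating Hörmander principal
parts (the flip-conjugates of the Fokker–Planck operator `L* - Nε`, CEHR Prop. 4.1) and constant
zeroth-order coupling `-ε [w' = w ∆ {i}]`, hence are smooth functions by the hypoellipticity of
such systems (`Literature.Analysis.Hypoelliptic.isSmoothOn_of_coupledSystem`, Hörmander 1967
Thm 1.1 with Kohn's bootstrap run jointly; Helffer–Nier LNM 1862 §2). [folklore] -/
theorem stub_flipSteadyState_hasSmoothDensity :
    ∀ ω₂ lam β γ : ℝ, 0 < ω₂ → 0 < lam → 0 < β → 0 < γ → ∀ ε : ℝ, 0 < ε →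
      ∀ (N : ℕ) (T_L T_R : ℝ), 0 < N → 0 < T_L → 0 < T_R →
        ∀ μ : MeasureTheory.Measure
            (Literature.MathematicalPhysics.KineticTheory.HeatConduction.PhaseSpace N),
          (Literature.MathematicalPhysics.KineticTheory.HeatConduction.pinnedChain
              ω₂ lam β γ).IsFlipSteadyState N T_L T_R ε μ →
          Literature.MathematicalPhysics.KineticTheory.HeatConduction.HasSmoothDensity μ := by
  intro ω₂ lam β γ hω hl hβ hγ ε hε N T_L T_R hN hL hR μ hμ
  classical
  set P := pinnedChain ω₂ lam β γ with hP
  have hU : ContDiff ℝ ∞ P.U := pinnedChain_contDiff_U ω₂ lam β γ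
  have hV : ContDiff ℝ ∞ P.V := pinnedChain_contDiff_V ω₂ lam β γ
  have hγ' : P.γ = γ := rfl
  have hγL : 0 < P.γ * T_L := by rw [hγ']; positivity
  have hγR : 0 ≤ P.γ * T_R := by rw [hγ']; positivity
  have hV2 : ∀ r, deriv (deriv P.V) r ≠ 0 := fun r => by
    rw [hP, pinnedChain_deriv_deriv_V]; positivity
  haveI := isAddHaarMeasure_volume_phaseSpace N
  haveI : IsProbabilityMeasure μ := hμ.1
  -- the multi-site flips `Θ_w`, as continuous linear involutions `A w`
  choose A hA hAs using fun w : Finset (Fin N) => exists_multiFlip_clEquiv (N := N) w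
  have hAflip : ∀ w (i : Fin N) x, A w (momentumFlip i x) = A (symmDiff w {i}) x :=
    multiFlip_momentumFlip_eq hA
  -- Hörmander data of `L* - Nε` and their flip conjugates
  set X₀ : PhaseSpace N → PhaseSpace N := P.adjointDrift N with hX₀
  set X : Fin 2 → PhaseSpace N → PhaseSpace N := P.bathField hN T_L T_R with hX
  set c₀ : ℝ := 2 * P.γ - (N : ℝ) * ε with hc₀
  have hX₀s : ContDiff ℝ ∞ X₀ := P.contDiff_adjointDrift hU hV N
  have hXs : ∀ j, ContDiff ℝ ∞ (X j) := fun _ => contDiff_const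
  set Y₀ : Finset (Fin N) → PhaseSpace N → PhaseSpace N := fun w y => A w (X₀ ((A w).symm y))
    with hY₀
  set Y : Finset (Fin N) → Fin 2 → PhaseSpace N → PhaseSpace N :=
    fun w j y => A w (X j ((A w).symm y)) with hY
  set cw : Finset (Fin N) → PhaseSpace N → ℝ := fun _ _ => c₀ with hcw
  have hY₀s : ∀ w, ContDiff ℝ ∞ (Y₀ w) := fun w => contDiff_conj (A w) hX₀s
  have hYs : ∀ w j, ContDiff ℝ ∞ (Y w j) := fun w j => contDiff_conj (A w) (hXs j)
  have hcws : ∀ w, ContDiff ℝ ∞ (cw w) := fun _ => contDiff_const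
  have hgen : ∀ w, IsBracketGenerating (fun o : Option (Fin 2) => o.elim (Y₀ w) (Y w))
      ((⊤ : Opens (PhaseSpace N)) : Set (PhaseSpace N)) := fun w => by
    rw [Opens.coe_top]
    exact isBracketGenerating_elim_conj (A w)
      (P.isBracketGenerating_hormanderFamily hN T_L T_R hU hV hγL hV2)
  -- the pushed-forward measures `(Θ_w)_* μ`, read as distributions
  set ν : Finset (Fin N) → Measure (PhaseSpace N) := fun w => μ.map (A w) with hν
  have hAm : ∀ w, AEMeasurable (A w) μ := fun w => (A w).continuous.measurable.aemeasurable
  haveI hνp : ∀ w, IsProbabilityMeasure (ν w) := fun w => Measure.isProbabilityMeasure_map (hAm w)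
  set u : Finset (Fin N) → 𝓓'((⊤ : Opens (PhaseSpace N)), ℝ) :=
    fun w => measureDistribution (ν w) ⊤ with hudef
  have hu : ∀ w (φ : 𝓓((⊤ : Opens (PhaseSpace N)), ℝ)), u w φ = ∫ x, φ (A w x) ∂μ := by
    intro w φ
    show measureDistribution (ν w) ⊤ φ = _
    rw [measureDistribution_apply]
    exact integral_map (hAm w) (φ.continuous.aestronglyMeasurable)
  -- the coupling matrix `a w w' = -ε [∃ i, w' = w ∆ {i}]`
  set a : Finset (Fin N) → Finset (Fin N) → ℝ :=
    fun w w' => ∑ i : Fin N, if w' = symmDiff w {i} then -ε else 0 with ha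
  have hsum : ∀ w (t : Finset (Fin N) → ℝ),
      ∑ w', a w w' * t w' = -ε * ∑ i : Fin N, t (symmDiff w {i}) := by
    intro w t
    simp only [ha, Finset.sum_mul, ite_mul, zero_mul]
    rw [Finset.sum_comm]
    simp only [Finset.sum_ite_eq', Finset.mem_univ, if_true, Finset.mul_sum]
  -- the coupled system `P_w u_w = ∑_{w'} a_{w w'} u_{w'}`
  have hfu : ∀ w (φ ψ : 𝓓((⊤ : Opens (PhaseSpace N)), ℝ)),
      tsupport (φ : PhaseSpace N → ℝ) ⊆ univ →
      (ψ : PhaseSpace N → ℝ) = hormanderTranspose (Y₀ w) (Y w) (cw w) φ →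
      u w ψ = (∫ x, (fun (_ : Finset (Fin N)) (_ : PhaseSpace N) => (0 : ℝ)) w x * φ x ∂volume) +
        ∑ w', a w w' * u w' φ := by
    intro w φ ψ _ hψ
    simp only [zero_mul, integral_zero, zero_add]
    rw [hsum w fun w' => u w' φ, hu]
    simp only [hu]
    -- the conjugated test function `g = φ ∘ Θ_w`
    set g : PhaseSpace N → ℝ := (φ : PhaseSpace N → ℝ) ∘ (A w) with hg
    have hgs : ContDiff ℝ ∞ g := φ.contDiff.comp (A w).contDiff
    have hgc : HasCompactSupport g := φ.hasCompactSupport.comp_homeomorph (A w).toHomeomorph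
    -- `ψ ∘ Θ_w = ᵗP (φ ∘ Θ_w) = (L - Nε) g = L_ε g - ε ∑_i g ∘ Θ_i`
    have hψg : ∀ x, ψ (A w x) = hormanderTranspose X₀ X (fun _ => c₀) g x := by
      intro x
      rw [show ψ (A w x) = (ψ : PhaseSpace N → ℝ) (A w x) from rfl, hψ]
      have e := hormanderTranspose_comp_equiv (A w) X₀ X (fun _ => c₀) φ x
      exact e.symm
    have hT : ∀ x, hormanderTranspose X₀ X (fun _ => c₀) g x =
        P.flipGenerator N T_L T_R ε g x - ε * ∑ i : Fin N, φ (A (symmDiff w {i}) x) := by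
      intro x
      rw [hc₀, Theorems.OddSectorIrreversibility.hormanderTranspose_shift P hU hV hN hγL.le hγR _ hgs,
        generator_sub_eq_flipGenerator_sub]
      simp only [hg, Function.comp_apply, hAflip]
    -- integrability
    have hTc : Continuous (hormanderTranspose X₀ X (fun _ => c₀) g) :=
      (contDiff_hormanderTranspose hX₀s hXs contDiff_const hgs).continuous
    have hTs : HasCompactSupport (hormanderTranspose X₀ X (fun _ => c₀) g) :=
      hgc.mono' ((subset_tsupport _).trans (tsupport_hormanderTranspose_subset X₀ X _ g))
    have hTi : Integrable (hormanderTranspose X₀ X (fun _ => c₀) g) μ :=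
      hTc.integrable_of_hasCompactSupport hTs
    have hφi : ∀ w', Integrable (fun x => φ (A w' x)) μ := fun w' =>
      (φ.continuous.comp (A w').continuous).integrable_of_hasCompactSupport
        (φ.hasCompactSupport.comp_homeomorph (A w').toHomeomorph)
    have hGi : Integrable (fun x => ε * ∑ i : Fin N, φ (A (symmDiff w {i}) x)) μ :=
      (integrable_finsetSum _ fun i _ => hφi _).const_mul ε
    have hFi : Integrable (P.flipGenerator N T_L T_R ε g) μ := by
      have := hTi.add hGi
      refine this.congr (Eventually.of_forall fun x => ?_)
      simp only [Pi.add_apply, hT]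
      ring
    -- assemble
    simp_rw [hψg, hT]
    rw [integral_sub hFi hGi, hμ.2.1 g hgs hgc, zero_sub, integral_const_mul,
      integral_finsetSum _ fun i _ => hφi _, neg_mul]
  -- hypoellipticity of the coupled system: `u_∅ = μ` is a smooth function
  have hsm := isSmoothOn_of_coupledSystem (volume : Measure (PhaseSpace N)) hY₀s hYs hcws hgen
    a u isOpen_univ (subset_univ _) (f := fun _ _ => (0 : ℝ)) (fun _ => contDiffOn_const) hfu ∅
  have hA0 : (A ∅ : PhaseSpace N → PhaseSpace N) = id := funext (multiFlip_empty_eq hA)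
  have hν0 : ν ∅ = μ := by
    show μ.map (A ∅) = μ
    rw [hA0, Measure.map_id]
  have hsm' : IsSmoothOn (measureDistribution μ (⊤ : Opens (PhaseSpace N))) volume univ := by
    have e : u ∅ = measureDistribution μ ⊤ := by
      show measureDistribution (ν ∅) ⊤ = _
      rw [hν0]
    rw [← e]
    exact hsm
  obtain ⟨ρ, hρ, hρ0, hμρ⟩ := IsSmoothOn.exists_eq_withDensity (m := μ) hsm'
  exact ⟨ρ, hρ, hρ0, hμρ⟩

end Summit.AtomisticToContinuum.FouriersLaw.Cruxes.NoisyFourier.SectorDirichletGluing
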